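import Literature.Computability.Complexity.SymPlusProofs
import HarnessLib

/-!
# Beigel–Tarui gate polynomials with explicit summation order

R. Beigel, J. Tarui, *On ACC*, Comput. Complexity 4 (1994), Lemma 2.1 and Lemma 2.5; R. Williams,
*Nonuniform ACC circuit lower bounds*, J. ACM 61 (2014), Appendix A. The tree's `SymPlusProofs.lean`
defines the defining polynomial `BT.Setup.FF v` of every variable of the collapse (randomized
AND/OR gates `andF`/`orF`, composite `MODₘ` gates `modF`, auxiliary `MOD_{p^e}` values `auxF` via
the elementary symmetric polynomials `esymF`) with sums and products taken over `Finset.toList`,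
whose order is unspecified: fine for the existence theorem proved there, but an ALGORITHM printing
the `SYM⁺` circuit (Williams' Lemma 4.1) must produce one definite list of AND-terms. This file
re-defines the same polynomials with every sum and product in an explicit order —

* `selL` (selected argument positions as an increasing list), `andF'`, `orF'`, `modF'` (prime factors
  in increasing order, `primesL`), `esymF'` (the `q`-subsets as `List.sublistsLen q` of the argument
  positions), `auxF'`, `gateF'`, `auxFj'`, and the defining polynomial **`FF'`**;

and proves that nothing else changes:

* `eval_FF'_eq` — `FF' v` and `FF v` take the same value at the valuation of every input, whence the
  defining equation `val_eq_indNZ'` (`val v = [FF' v ≢ 0 (mod primeOf v)]`, from the tree's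
  `val_eq_indNZ`); the only new computation is the value of `esymF'`, the number of `q`-subsets of
  the true arguments (`sum_sublistsLen_prod_b2i`, `eval_esymF'`);
* `deg_FF'_le`, `wt_FF'_le`, `varsIn_FF'` — the degree, weight and variable bounds of
  `SymPlusProofs.lean` (`deg_FF_le`, `wt_FF_le`, `varsIn_FF`) verbatim for the primed polynomials.

No new named fact; everything is proved. Consumed by the explicit collapse
(`Williams2014Collapse.lean`) and mirrored token by token by the polynomial-time conversion.

## References

* R. Beigel, J. Tarui, *On ACC*, Comput. Complexity 4 (1994) 350–366, Lemma 2.1, Lemma 2.5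
  [BeigelTarui1994].
* R. Williams, *Nonuniform ACC circuit lower bounds*, J. ACM 61 (2014), Appendix A [Williams2014].
-/

namespace Literature.Computability.Complexity

open Finset

namespace BT

/-! ### A counting identity for elementary symmetric polynomials of `{0,1}`-values -/

/-- `Σ_{A ∈ sublistsLen q l} ∏_{a ∈ A} [v a] = (#{a ∈ l | v a} choose q)`: the `q`-th elementary
symmetric polynomial of `{0,1}`-values counts the `q`-subsets of the ones (Beigel–Tarui 1994,
Lemma 2.1: "`e_k(x) = (|x| choose k)`"). [cite: BeigelTarui1994, Lemma 2.1] -/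
theorem sum_sublistsLen_prod_b2i {α : Type*} (v : α → Bool) :
    ∀ (q : ℕ) (l : List α), ((l.sublistsLen q).map fun A => (A.map fun a => b2i (v a)).prod).sum =
      ((l.countP v).choose q : ℤ)
  | 0, [] => by simp
  | q + 1, [] => by simp
  | 0, a :: l => by simp [List.sublistsLen_zero]
  | q + 1, a :: l => by
    rw [List.sublistsLen_succ_cons, List.map_append, List.sum_append, sum_sublistsLen_prod_b2i v (q + 1) l,
      List.map_map]
    have h2 : ((l.sublistsLen q).map ((fun A => (A.map fun a => b2i (v a)).prod) ∘ List.cons a)).sum =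
        b2i (v a) * ((l.countP v).choose q : ℤ) := by
      rw [← sum_sublistsLen_prod_b2i v q l, ← List.sum_map_mul_left]
      rfl
    rw [h2, List.countP_cons]
    cases v a
    · simp
    · simp only [b2i_true, one_mul, ite_true, Nat.choose_succ_succ', Nat.cast_add]
      ring

/-- The prime factors of `m` in increasing order. [folklore] -/
def primesL (m : ℕ) : List ℕ := (List.range (m + 1)).filter fun p => p ∈ m.primeFactors

/-- Membership in `primesL`. [folklore] -/
@[simp] theorem mem_primesL {m p : ℕ} : p ∈ primesL m ↔ p ∈ m.primeFactors := by
  simp only [primesL, List.mem_filter, List.mem_range, decide_eq_true_eq, and_iff_right_iff_imp]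
  exact fun hp => Nat.lt_succ_of_le (Nat.le_of_mem_primeFactors hp)

/-- `primesL` has no duplicates. [folklore] -/
theorem nodup_primesL (m : ℕ) : (primesL m).Nodup := List.nodup_range.filter _

/-- `primesL m` lists `m.primeFactors`. [folklore] -/
theorem toFinset_primesL (m : ℕ) : (primesL m).toFinset = m.primeFactors := by
  ext p; simp

/-- `m` has at most `m + 1` prime factors (a crude bound). [folklore] -/
theorem length_primesL_le (m : ℕ) : (primesL m).length ≤ m + 1 :=
  (List.length_filter_le _ _).trans (by simp)

namespace Setup

variable {n : ℕ} (K : Setup n)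

/-! ### The gate polynomials, list-ordered -/

section gates

variable (c j : ℕ) (g : Gate (Fin n))

/-- The positions selected by trial `t`, in increasing order. [cite: BeigelTarui1994, Remark 2.4] -/
def selL (t : ℕ) : List (Fin g.arity) := (List.finRange g.arity).filter fun a => K.βs c j t a

/-- AND gate: `∏_t (1 - ∑_{a ∈ selL t} (1 - ℓ_a))`. [cite: BeigelTarui1994, Lemma 2.5, Case 2] -/
def andF' : AForm (V n) :=
  AForm.prodL ((List.range K.T₀).map fun t =>
    (AForm.sumL ((K.selL c j g t).map fun a => (K.litF c (g.args a)).oneSub)).oneSub)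

/-- OR gate: `1 - ∏_t (1 - ∑_{a ∈ selL t} ℓ_a)`. [cite: BeigelTarui1994, Lemma 2.5, Case 2] -/
def orF' : AForm (V n) :=
  (AForm.prodL ((List.range K.T₀).map fun t =>
    (AForm.sumL ((K.selL c j g t).map fun a => K.litF c (g.args a))).oneSub)).oneSub

/-- MOD gate: `1 - ∏_{p ∣ m} (1 - u_p)`, primes increasing. [cite: BeigelTarui1994, Lemma 2.5, Case 1] -/
def modF' : AForm (V n) :=
  (AForm.prodL ((primesL K.m).map fun p => (AForm.var (.inr (c, j, p))).oneSub)).oneSub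

/-- Elementary symmetric polynomial of degree `q` in the argument literals, the `q`-subsets in the
order of `List.sublistsLen`. [cite: BeigelTarui1994, Lemma 2.1] -/
def esymF' (q : ℕ) : AForm (V n) :=
  AForm.sumL (((List.finRange g.arity).sublistsLen q).map fun A =>
    AForm.prodL (A.map fun a => K.litF c (g.args a)))

/-- Auxiliary `MOD_{p^e}` polynomial `1 - ∏_{t<e} (1 - e_{p^t}^{p-1})`. [cite: BeigelTarui1994, Lemma 2.1] -/
def auxF' (p : ℕ) : AForm (V n) :=
  (AForm.prodL ((List.range (K.m.factorization p)).map fun t =>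
    ((K.esymF' c g (p ^ t)).pow (p - 1)).oneSub)).oneSub

end gates

/-- The polynomial of gate `j` of copy `c` (prime `2`). [cite: BeigelTarui1994, Lemma 2.5] -/
def gateF' (c j : ℕ) : AForm (V n) :=
  if hj : j < K.C.gates.length then
    if accCode K.m (K.C.gates[j]).fn = 1 then K.andF' c j (K.C.gates[j])
    else if accCode K.m (K.C.gates[j]).fn = 2 then K.orF' c j (K.C.gates[j])
    else K.modF' c j
  else AForm.cst 0

/-- The auxiliary polynomial of gate `j` of copy `c` for the prime `p`. [cite: BeigelTarui1994, Lemma 2.1] -/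
def auxFj' (c j p : ℕ) : AForm (V n) :=
  if hj : j < K.C.gates.length then K.auxF' c (K.C.gates[j]) p else AForm.cst 0

/-- **The defining polynomial of a variable, list-ordered.** [cite: BeigelTarui1994, Lemma 2.5] -/
def FF' : V n → AForm (V n)
  | .inl _ => AForm.cst 0
  | .inr (c, j, 0) => K.gateF' c j
  | .inr (c, j, q + 1) => K.auxFj' c j (q + 1)

/-! ### Same values as the `Finset`-ordered polynomials -/

/-- A sum over the increasing list of selected positions is the `Finset` sum. [folklore] -/
theorem eval_sumL_filter_finRange {σ : Type*} {k : ℕ} (p : Fin k → Bool) (f : Fin k → AForm σ) (ν : σ → ℤ) :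
    (AForm.sumL (((List.finRange k).filter p).map f)).eval ν =
      (AForm.sumL ((univ.filter fun a => p a = true).toList.map f)).eval ν := by
  rw [eval_sumL_toList, AForm.eval_sumL, List.map_map]
  have hset : ((List.finRange k).filter p).toFinset = univ.filter fun a => p a = true := by
    ext a; simp
  rw [← hset, List.sum_toFinset _ (List.nodup_finRange k |>.filter _)]
  rfl

/-- `andF'` has the value of `andF`. [folklore] -/
theorem eval_andF'_eq (c j : ℕ) (g : Gate (Fin n)) (ν : V n → ℤ) :
    (K.andF' c j g).eval ν = (K.andF c j g).eval ν := by
  simp only [andF', andF, AForm.eval_prodL, List.map_map]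
  congr 1
  refine List.map_congr_left fun t _ => ?_
  simp only [Function.comp_apply, AForm.eval_oneSub]
  rw [selL, sel, eval_sumL_filter_finRange]

/-- `orF'` has the value of `orF`. [folklore] -/
theorem eval_orF'_eq (c j : ℕ) (g : Gate (Fin n)) (ν : V n → ℤ) :
    (K.orF' c j g).eval ν = (K.orF c j g).eval ν := by
  simp only [orF', orF, AForm.eval_oneSub, AForm.eval_prodL, List.map_map]
  congr 2
  refine List.map_congr_left fun t _ => ?_
  simp only [Function.comp_apply, AForm.eval_oneSub]
  rw [selL, sel, eval_sumL_filter_finRange]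

/-- `modF'` has the value of `modF`. [folklore] -/
theorem eval_modF'_eq (c j : ℕ) (ν : V n → ℤ) : (K.modF' c j).eval ν = (K.modF c j).eval ν := by
  simp only [modF', modF, AForm.eval_oneSub, AForm.eval_prodL, List.map_map]
  congr 1
  rw [← List.prod_toFinset _ (nodup_primesL K.m), ← List.prod_toFinset _ (Finset.nodup_toList _),
    toFinset_primesL, Finset.toList_toFinset]

/-- Counting over `finRange` is the cardinality of the filtered `univ`. [folklore] -/
theorem countP_finRange_eq_card {k : ℕ} (p : Fin k → Bool) :
    (List.finRange k).countP p = #(univ.filter fun a => p a = true) := by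
  have hset : ((List.finRange k).filter p).toFinset = univ.filter fun a => p a = true := by
    ext a; simp
  rw [List.countP_eq_length_filter, ← hset, List.toFinset_card_of_nodup (List.nodup_finRange k |>.filter _)]

/-- **`e_q` at the argument literals counts the `q`-subsets of the true arguments.**
[cite: BeigelTarui1994, Lemma 2.1] -/
theorem eval_esymF' (c : ℕ) (g : Gate (Fin n)) (q : ℕ) (x : Fin n → Bool) :
    (K.esymF' c g q).eval (K.val x) =
      ((#(univ.filter fun a : Fin g.arity => K.rv c x (g.args a) = true)).choose q : ℕ) := by
  simp only [esymF', AForm.eval_sumL, AForm.eval_prodL, List.map_map, Function.comp_def, eval_litF]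
  rw [← countP_finRange_eq_card]
  exact sum_sublistsLen_prod_b2i (fun a => K.rv c x (g.args a)) q (List.finRange g.arity)

/-- `esymF'` has the value of `esymF` at the valuation of an input. [folklore] -/
theorem eval_esymF'_eq (c : ℕ) (g : Gate (Fin n)) (q : ℕ) (x : Fin n → Bool) :
    (K.esymF' c g q).eval (K.val x) = (K.esymF c g q).eval (K.val x) := by
  rw [eval_esymF', eval_esymF]

/-- `auxF'` has the value of `auxF` at the valuation of an input. [folklore] -/
theorem eval_auxF'_eq (c : ℕ) (g : Gate (Fin n)) (p : ℕ) (x : Fin n → Bool) :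
    (K.auxF' c g p).eval (K.val x) = (K.auxF c g p).eval (K.val x) := by
  simp only [auxF', auxF, AForm.eval_oneSub, AForm.eval_prodL, List.map_map, Function.comp_def,
    AForm.eval_pow, eval_esymF'_eq]

/-- `gateF'` has the value of `gateF` at the valuation of an input. [folklore] -/
theorem eval_gateF'_eq (c j : ℕ) (x : Fin n → Bool) :
    (K.gateF' c j).eval (K.val x) = (K.gateF c j).eval (K.val x) := by
  unfold gateF' gateF
  split_ifs
  · exact K.eval_andF'_eq c j _ _
  · exact K.eval_orF'_eq c j _ _
  · exact K.eval_modF'_eq c j _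
  · rfl

/-- `auxFj'` has the value of `auxFj` at the valuation of an input. [folklore] -/
theorem eval_auxFj'_eq (c j p : ℕ) (x : Fin n → Bool) :
    (K.auxFj' c j p).eval (K.val x) = (K.auxFj c j p).eval (K.val x) := by
  unfold auxFj' auxFj
  split_ifs
  · exact K.eval_auxF'_eq c _ p x
  · rfl

/-- **`FF'` has the value of `FF`** at the valuation of every input. [folklore] -/
theorem eval_FF'_eq (x : Fin n → Bool) : ∀ v : V n, (K.FF' v).eval (K.val x) = (K.FF v).eval (K.val x)
  | .inl _ => rfl
  | .inr (c, j, 0) => K.eval_gateF'_eq c j x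
  | .inr (c, j, q + 1) => K.eval_auxFj'_eq c j (q + 1) x

/-- **The defining equation with the list-ordered polynomials**: the value of an admissible
non-input variable is `[FF' v ≢ 0 (mod primeOf v)]`. [cite: BeigelTarui1994, Lemma 2.1 and Lemma 2.5] -/
theorem val_eq_indNZ' (x : Fin n → Bool) {v : V n} (hv : K.Adm v) (hl : K.level v ≠ 0) :
    K.val x v = AForm.indNZ (primeOf v) ((K.FF' v).eval (K.val x)) := by
  rw [K.eval_FF'_eq x v]
  exact K.val_eq_indNZ x hv hl

/-! ### Degree, weight and variables -/

section bounds

variable (c j : ℕ) (g : Gate (Fin n))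

/-- `|selL t| ≤ arity`. [folklore] -/
theorem length_selL_le (t : ℕ) : (K.selL c j g t).length ≤ g.arity :=
  (List.length_filter_le _ _).trans (by simp)

/-- Degree of the AND polynomial: `≤ T₀`. [cite: BeigelTarui1994, Lemma 2.5] -/
theorem deg_andF'_le : (K.andF' c j g).deg ≤ K.T₀ := by
  unfold andF'
  refine (AForm.deg_prodL_le (D := 1) fun F hF => ?_).trans (by simp)
  simp only [List.mem_map, List.mem_range] at hF
  obtain ⟨t, -, rfl⟩ := hF
  rw [AForm.deg_oneSub]
  refine AForm.deg_sumL_le fun G hG => ?_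
  simp only [List.mem_map] at hG
  obtain ⟨a, -, rfl⟩ := hG
  rw [AForm.deg_oneSub, deg_litF]

/-- Degree of the OR polynomial: `≤ T₀`. [cite: BeigelTarui1994, Lemma 2.5] -/
theorem deg_orF'_le : (K.orF' c j g).deg ≤ K.T₀ := by
  unfold orF'
  rw [AForm.deg_oneSub]
  refine (AForm.deg_prodL_le (D := 1) fun F hF => ?_).trans (by simp)
  simp only [List.mem_map, List.mem_range] at hF
  obtain ⟨t, -, rfl⟩ := hF
  rw [AForm.deg_oneSub]
  refine AForm.deg_sumL_le fun G hG => ?_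
  simp only [List.mem_map] at hG
  obtain ⟨a, -, rfl⟩ := hG
  rw [deg_litF]

/-- Degree of the MOD polynomial: `≤ m + 1`. [cite: BeigelTarui1994, Lemma 2.5] -/
theorem deg_modF'_le : (K.modF' c j).deg ≤ K.m + 1 := by
  unfold modF'
  rw [AForm.deg_oneSub]
  refine (AForm.deg_prodL_le (D := 1) fun F hF => ?_).trans ?_
  · simp only [List.mem_map] at hF
    obtain ⟨p, -, rfl⟩ := hF
    rfl
  · simpa using length_primesL_le K.m

/-- Degree of `e_q`: `≤ q`. [cite: BeigelTarui1994, Lemma 2.1] -/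
theorem deg_esymF'_le (q : ℕ) : (K.esymF' c g q).deg ≤ q := by
  unfold esymF'
  refine AForm.deg_sumL_le fun F hF => ?_
  simp only [List.mem_map, List.mem_sublistsLen] at hF
  obtain ⟨A, ⟨-, hA⟩, rfl⟩ := hF
  refine (AForm.deg_prodL_le (D := 1) fun G hG => ?_).trans ?_
  · simp only [List.mem_map] at hG
    obtain ⟨a, -, rfl⟩ := hG
    rw [deg_litF]
  · simp [hA]

/-- Degree of the auxiliary `MOD_{p^e}` polynomial: `≤ m³`. [cite: BeigelTarui1994, Lemma 2.1] -/
theorem deg_auxF'_le {p : ℕ} (hp : p ∈ K.m.primeFactors) : (K.auxF' c g p).deg ≤ K.m ^ 3 := by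
  unfold auxF'
  rw [AForm.deg_oneSub]
  have he : K.m.factorization p ≤ K.m := (Nat.factorization_lt p K.m_ne_zero).le
  have hp1 : p - 1 ≤ K.m := (Nat.sub_le p 1).trans (Nat.le_of_mem_primeFactors hp)
  refine (AForm.deg_prodL_le (D := K.m * K.m) fun F hF => ?_).trans ?_
  · simp only [List.mem_map, List.mem_range] at hF
    obtain ⟨t, ht, rfl⟩ := hF
    rw [AForm.deg_oneSub, AForm.deg_pow]
    exact Nat.mul_le_mul hp1 ((K.deg_esymF'_le c g _).trans (K.pow_factorization_le hp ht.le))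
  · rw [List.length_map, List.length_range]
    calc K.m.factorization p * (K.m * K.m) ≤ K.m * (K.m * K.m) := Nat.mul_le_mul_right _ he
      _ = K.m ^ 3 := by ring

/-- Weight of the AND polynomial: `≤ (3k+2)^{T₀}` for arity `k`. [cite: BeigelTarui1994, Lemma 2.5] -/
theorem wt_andF'_le : (K.andF' c j g).wt ≤ (3 * g.arity + 2) ^ K.T₀ := by
  unfold andF'
  refine (AForm.wt_prodL_le (W := 3 * g.arity + 2) fun F hF => ?_).trans (by simp)
  simp only [List.mem_map, List.mem_range] at hF
  obtain ⟨t, -, rfl⟩ := hF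
  rw [AForm.wt_oneSub]
  refine Nat.succ_le_succ ((AForm.wt_sumL_le (W := 3) fun G hG => ?_).trans ?_)
  · simp only [List.mem_map] at hG
    obtain ⟨a, -, rfl⟩ := hG
    rw [AForm.wt_oneSub]
    exact Nat.succ_le_succ (wt_litF_le K c _)
  · rw [List.length_map]
    have := K.length_selL_le c j g t
    nlinarith

/-- Weight of the OR polynomial: `≤ (3k+3)^{T₀}` for arity `k`. [cite: BeigelTarui1994, Lemma 2.5] -/
theorem wt_orF'_le (hT : 1 ≤ K.T₀) : (K.orF' c j g).wt ≤ (3 * g.arity + 3) ^ K.T₀ := by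
  unfold orF'
  rw [AForm.wt_oneSub]
  refine le_trans (Nat.succ_le_succ ((AForm.wt_prodL_le (W := 3 * g.arity + 2) fun F hF => ?_).trans
    (le_of_eq (by simp)))) (pow_add_one_le hT)
  simp only [List.mem_map, List.mem_range] at hF
  obtain ⟨t, -, rfl⟩ := hF
  rw [AForm.wt_oneSub]
  refine Nat.succ_le_succ ((AForm.wt_sumL_le (W := 2) fun G hG => ?_).trans ?_)
  · simp only [List.mem_map] at hG
    obtain ⟨a, -, rfl⟩ := hG
    exact wt_litF_le K c _
  · rw [List.length_map]
    have := K.length_selL_le c j g t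
    nlinarith

/-- Weight of the MOD polynomial: `≤ 3^{m+1}`. [cite: BeigelTarui1994, Lemma 2.5] -/
theorem wt_modF'_le : (K.modF' c j).wt ≤ 3 ^ (K.m + 1) := by
  unfold modF'
  rw [AForm.wt_oneSub]
  have h1 : (AForm.prodL ((primesL K.m).map fun p =>
      (AForm.var (Sum.inr (c, j, p)) : AForm (V n)).oneSub)).wt ≤ 2 ^ (K.m + 1) := by
    refine (AForm.wt_prodL_le (W := 2) fun F hF => ?_).trans ?_
    · simp only [List.mem_map] at hF
      obtain ⟨p, -, rfl⟩ := hF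
      rfl
    · rw [List.length_map]
      exact Nat.pow_le_pow_right (by norm_num) (length_primesL_le K.m)
  exact (Nat.succ_le_succ h1).trans (pow_add_one_le (Nat.succ_pos _))

/-- Weight of `e_q`: `≤ k^q 2^q + 1` for arity `k`. [cite: BeigelTarui1994, Lemma 2.1] -/
theorem wt_esymF'_le (q : ℕ) : (K.esymF' c g q).wt ≤ g.arity ^ q * 2 ^ q + 1 := by
  unfold esymF'
  refine (AForm.wt_sumL_le (W := 2 ^ q) fun F hF => ?_).trans ?_
  · simp only [List.mem_map, List.mem_sublistsLen] at hF
    obtain ⟨A, ⟨-, hA⟩, rfl⟩ := hF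
    refine (AForm.wt_prodL_le (W := 2) fun G hG => ?_).trans (by rw [List.length_map, hA])
    simp only [List.mem_map] at hG
    obtain ⟨a, -, rfl⟩ := hG
    exact wt_litF_le K c _
  · rw [List.length_map, List.length_sublistsLen, List.length_finRange]
    exact Nat.succ_le_succ (Nat.mul_le_mul_right _ (Nat.choose_le_pow _ _))

/-- Weight of the auxiliary `MOD_{p^e}` polynomial: `≤ (2k+3)^{m³}` for arity `k`.
[cite: BeigelTarui1994, Lemma 2.1] -/
theorem wt_auxF'_le {p : ℕ} (hp : p ∈ K.m.primeFactors) :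
    (K.auxF' c g p).wt ≤ (2 * g.arity + 3) ^ K.m ^ 3 := by
  unfold auxF'
  rw [AForm.wt_oneSub]
  have he : K.m.factorization p ≤ K.m := (Nat.factorization_lt p K.m_ne_zero).le
  have hp1 : p - 1 ≤ K.m := (Nat.sub_le p 1).trans (Nat.le_of_mem_primeFactors hp)
  have hm3 : 1 ≤ K.m ^ 3 := Nat.one_le_pow _ _ (Nat.pos_of_ne_zero K.m_ne_zero)
  set k := g.arity
  have hfac : ∀ t < K.m.factorization p,
      (((K.esymF' c g (p ^ t)).pow (p - 1)).oneSub).wt ≤ (2 * k + 2) ^ (K.m * K.m) := by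
    intro t ht
    have hq : p ^ t ≤ K.m := K.pow_factorization_le hp ht.le
    have hq1 : 1 ≤ p ^ t := Nat.one_le_pow _ _ (Nat.prime_of_mem_primeFactors hp).pos
    rw [AForm.wt_oneSub, AForm.wt_pow]
    have h1 : (K.esymF' c g (p ^ t)).wt ≤ (2 * k + 1) ^ (p ^ t) := by
      refine (K.wt_esymF'_le c g _).trans ?_
      rw [← mul_pow]
      refine (pow_add_one_le hq1).trans ?_
      exact Nat.pow_le_pow_left (by omega) _
    calc (K.esymF' c g (p ^ t)).wt ^ (p - 1) + 1 ≤ ((2 * k + 1) ^ (p ^ t)) ^ (p - 1) + 1 :=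
          Nat.succ_le_succ (Nat.pow_le_pow_left h1 _)
      _ = (2 * k + 1) ^ (p ^ t * (p - 1)) + 1 := by rw [pow_mul]
      _ ≤ (2 * k + 1) ^ (K.m * K.m) + 1 := by
          refine Nat.succ_le_succ (Nat.pow_le_pow_right (by omega) (Nat.mul_le_mul hq hp1))
      _ ≤ (2 * k + 2) ^ (K.m * K.m) := pow_add_one_le (Nat.one_le_iff_ne_zero.2
          (Nat.mul_ne_zero K.m_ne_zero K.m_ne_zero))
  have hprod : (AForm.prodL ((List.range (K.m.factorization p)).map fun t =>
      ((K.esymF' c g (p ^ t)).pow (p - 1)).oneSub)).wt ≤ (2 * k + 2) ^ K.m ^ 3 := by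
    refine (AForm.wt_prodL_le (W := (2 * k + 2) ^ (K.m * K.m)) fun F hF => ?_).trans ?_
    · simp only [List.mem_map, List.mem_range] at hF
      obtain ⟨t, ht, rfl⟩ := hF
      exact hfac t ht
    · rw [List.length_map, List.length_range, ← pow_mul]
      refine Nat.pow_le_pow_right (by omega) ?_
      rw [pow_succ, pow_two]
      exact Nat.mul_le_mul_left _ he
  exact (Nat.succ_le_succ hprod).trans (pow_add_one_le hm3)

/-- Variables of the AND/OR polynomials: literals of the arguments. [folklore] -/
theorem varsIn_andF'_orF' {P : V n → Prop} (hP : ∀ a, (K.litF c (g.args a)).VarsIn P) :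
    (K.andF' c j g).VarsIn P ∧ (K.orF' c j g).VarsIn P := by
  have hfac : ∀ (F : AForm (V n)) (t : ℕ) (neg : Bool),
      F = (AForm.sumL ((K.selL c j g t).map fun a =>
        if neg then (K.litF c (g.args a)).oneSub else K.litF c (g.args a))).oneSub → F.VarsIn P := by
    rintro F t neg rfl
    refine (AForm.VarsIn_sumL fun G hG => ?_).oneSub
    simp only [List.mem_map] at hG
    obtain ⟨a, -, rfl⟩ := hG
    cases neg
    · exact hP a
    · exact (hP a).oneSub
  constructor
  · refine AForm.VarsIn_prodL fun F hF => ?_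
    simp only [List.mem_map, List.mem_range] at hF
    obtain ⟨t, -, rfl⟩ := hF
    exact hfac _ t true rfl
  · refine (AForm.VarsIn_prodL fun F hF => ?_).oneSub
    simp only [List.mem_map, List.mem_range] at hF
    obtain ⟨t, -, rfl⟩ := hF
    exact hfac _ t false rfl

/-- Variables of the MOD polynomial: the auxiliary variables of the gate. [folklore] -/
theorem varsIn_modF' {P : V n → Prop} (hP : ∀ p ∈ K.m.primeFactors, P (.inr (c, j, p))) :
    (K.modF' c j).VarsIn P := by
  refine (AForm.VarsIn_prodL fun F hF => ?_).oneSub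
  simp only [List.mem_map, mem_primesL] at hF
  obtain ⟨p, hp, rfl⟩ := hF
  exact (show (AForm.var (Sum.inr (c, j, p)) : AForm (V n)).VarsIn P from hP p hp).oneSub

/-- Variables of the auxiliary polynomial: those of the argument literals. [folklore] -/
theorem varsIn_auxF' {P : V n → Prop} (hP : ∀ a, (K.litF c (g.args a)).VarsIn P) (p : ℕ) :
    (K.auxF' c g p).VarsIn P := by
  refine (AForm.VarsIn_prodL fun F hF => ?_).oneSub
  simp only [List.mem_map, List.mem_range] at hF
  obtain ⟨t, -, rfl⟩ := hF
  refine (AForm.VarsIn.pow ?_ _).oneSub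
  refine AForm.VarsIn_sumL fun G hG => ?_
  simp only [List.mem_map] at hG
  obtain ⟨A, -, rfl⟩ := hG
  refine AForm.VarsIn_prodL fun H hH => ?_
  simp only [List.mem_map] at hH
  obtain ⟨a, -, rfl⟩ := hH
  exact hP a

end bounds

/-- **Degree of the defining polynomials**: `≤ T₀ + m³`. [cite: BeigelTarui1994, Lemma 2.1 and Lemma 2.5] -/
theorem deg_FF'_le (v : V n) : (K.FF' v).deg ≤ K.T₀ + K.m ^ 3 := by
  have hm3 := K.m_succ_le_cube
  rcases v with i | ⟨c, j, _ | q⟩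
  · exact Nat.zero_le _
  · show (K.gateF' c j).deg ≤ _
    unfold gateF'
    split_ifs with hj h1 h2
    · exact (K.deg_andF'_le c j _).trans (Nat.le_add_right _ _)
    · exact (K.deg_orF'_le c j _).trans (Nat.le_add_right _ _)
    · exact (K.deg_modF'_le c j).trans (hm3.trans (Nat.le_add_left _ _))
    · exact Nat.zero_le _
  · show (K.auxFj' c j (q + 1)).deg ≤ _
    unfold auxFj'
    split_ifs with hj
    · by_cases hp : q + 1 ∈ K.m.primeFactors
      · exact (K.deg_auxF'_le c _ hp).trans (Nat.le_add_left _ _)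
      · simp [auxF', K.factorization_eq_zero_of_not_mem hp, AForm.prodL, AForm.deg]
    · exact Nat.zero_le _

/-- **Weight of the defining polynomials**: `≤ (3s+3)^{T₀+m³}` for fan-in `≤ s`.
[cite: BeigelTarui1994, §2.4] -/
theorem wt_FF'_le {s : ℕ} (hfan : K.C.maxFanIn ≤ s) (hT : 1 ≤ K.T₀) (v : V n) :
    (K.FF' v).wt ≤ (3 * s + 3) ^ (K.T₀ + K.m ^ 3) := by
  have hm3 := K.m_succ_le_cube
  have hX : 1 ≤ 3 * s + 3 := by omega
  have hN : ∀ {y k : ℕ}, y ≤ 3 * s + 3 → k ≤ K.T₀ + K.m ^ 3 → y ^ k ≤ (3 * s + 3) ^ (K.T₀ + K.m ^ 3) :=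
    fun hy hk => (Nat.pow_le_pow_left hy _).trans (Nat.pow_le_pow_right hX hk)
  have h1 : 1 ≤ (3 * s + 3) ^ (K.T₀ + K.m ^ 3) := Nat.one_le_pow _ _ hX
  have harity : ∀ {j : ℕ} (hj : j < K.C.gates.length), (K.C.gates[j]).arity ≤ s := fun hj =>
    (arity_le_maxFanIn K.C (List.getElem_mem hj)).trans hfan
  rcases v with i | ⟨c, j, _ | q⟩
  · simpa [FF', AForm.wt] using h1
  · show (K.gateF' c j).wt ≤ _
    unfold gateF'
    split_ifs with hj h1' h2'
    · refine (K.wt_andF'_le c j _).trans (hN ?_ (Nat.le_add_right _ _))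
      have := harity hj; omega
    · refine (K.wt_orF'_le c j _ hT).trans (hN ?_ (Nat.le_add_right _ _))
      have := harity hj; omega
    · exact (K.wt_modF'_le c j).trans (hN (by omega) (hm3.trans (Nat.le_add_left _ _)))
    · simpa [AForm.wt] using h1
  · show (K.auxFj' c j (q + 1)).wt ≤ _
    unfold auxFj'
    split_ifs with hj
    · by_cases hp : q + 1 ∈ K.m.primeFactors
      · refine (K.wt_auxF'_le c _ hp).trans (hN ?_ (Nat.le_add_left _ _))
        have := harity hj; omega
      · have : (K.auxF' c (K.C.gates[j]) (q + 1)).wt = 2 := by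
          simp [auxF', K.factorization_eq_zero_of_not_mem hp, AForm.prodL, AForm.wt]
        rw [this]
        calc 2 ≤ (3 * s + 3) ^ 1 := by rw [pow_one]; omega
          _ ≤ _ := Nat.pow_le_pow_right hX (le_add_right hT)
    · simpa [AForm.wt] using h1

/-- **The defining polynomial of a variable mentions only admissible variables of smaller level.**
[cite: BeigelTarui1994, Lemma 2.8] -/
theorem varsIn_FF' {v : V n} (hv : K.Adm v) (hl : K.level v ≠ 0) :
    (K.FF' v).VarsIn fun w => K.Adm w ∧ K.level w + 1 ≤ K.level v := by
  rcases v with i | ⟨c, j, _ | q⟩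
  · exact absurd rfl hl
  · obtain ⟨hj, hc⟩ := hv
    have hc' : accCode K.m (K.C.gates[j]).fn ≠ 0 := by rwa [← K.code_eq hj]
    have hw := K.one_le_wdepth hj hc
    have hlit : ∀ a : Fin (K.C.gates[j]).arity, (K.litF c ((K.C.gates[j]).args a)).VarsIn
        fun w => K.Adm w ∧ K.level w + 1 ≤ K.level (.inr (c, j, 0)) := by
      intro a
      refine (K.varsIn_litF c _ (fun m' hm' => (K.C.wf j hj a m' hm').trans hj)).mono fun w hw' => ?_
      rcases hw' with ⟨i, rfl⟩ | ⟨j', rfl, hj', hc'', hd⟩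
      · refine ⟨trivial, ?_⟩
        show 0 + 1 ≤ (K.m + 1) * wdepth K.C (.inr j)
        nlinarith
      · refine ⟨⟨hj', hc''⟩, ?_⟩
        show (K.m + 1) * wdepth K.C (.inr j') + 1 ≤ (K.m + 1) * wdepth K.C (.inr j)
        have hlt := wdepth_args_lt K.C hj hc' a
        rw [← hd] at hlt
        have := K.level_step hlt
        omega
    show (K.gateF' c j).VarsIn _
    unfold gateF'
    rw [dif_pos hj]
    split_ifs with h1 h2
    · exact (K.varsIn_andF'_orF' c j _ hlit).1
    · exact (K.varsIn_andF'_orF' c j _ hlit).2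
    · refine K.varsIn_modF' c j fun p hp => ?_
      have hp0 : 0 < p := (Nat.prime_of_mem_primeFactors hp).pos
      have hpm : p ≤ K.m := Nat.le_of_mem_primeFactors hp
      refine ⟨(K.adm_aux c j hp0).2 ⟨hj, hc, hp⟩, ?_⟩
      rw [K.level_aux c j hp0]
      show (K.m + 1) * wdepth K.C (.inr j) - p + 1 ≤ (K.m + 1) * wdepth K.C (.inr j)
      have : (K.m + 1) * 1 ≤ (K.m + 1) * wdepth K.C (.inr j) := Nat.mul_le_mul_left _ hw
      omega
  · obtain ⟨hj, hc, hp⟩ := hv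
    have hc' : accCode K.m (K.C.gates[j]).fn ≠ 0 := by rwa [← K.code_eq hj]
    have hw := K.one_le_wdepth hj hc
    have hpm : q + 1 ≤ K.m := Nat.le_of_mem_primeFactors hp
    have hbase : (K.m + 1) * 1 ≤ (K.m + 1) * wdepth K.C (.inr j) := Nat.mul_le_mul_left _ hw
    show (K.auxFj' c j (q + 1)).VarsIn _
    unfold auxFj'
    rw [dif_pos hj]
    refine K.varsIn_auxF' c _ (fun a => ?_) (q + 1)
    refine (K.varsIn_litF c _ (fun m' hm' => (K.C.wf j hj a m' hm').trans hj)).mono fun w hw' => ?_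
    rcases hw' with ⟨i, rfl⟩ | ⟨j', rfl, hj', hc'', hd⟩
    · refine ⟨trivial, ?_⟩
      show 0 + 1 ≤ (K.m + 1) * wdepth K.C (.inr j) - (q + 1)
      omega
    · refine ⟨⟨hj', hc''⟩, ?_⟩
      show (K.m + 1) * wdepth K.C (.inr j') + 1 ≤ (K.m + 1) * wdepth K.C (.inr j) - (q + 1)
      have hlt := wdepth_args_lt K.C hj hc' a
      rw [← hd] at hlt
      have := K.level_step hlt
      omega

end Setup

end BT

end Literature.Computability.Complexity
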